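/-
Origin: expansion seat `prover-pub-hodgecm-mc-binder-2-g19-0`, handover #101 2026-08-21T00:35Z md5 d44a641938bb (NEW; 127 l.; ns HodgeCM.Literature.Theta.LiuAlbaneseModuleDatum (§1 generic) + HodgeCM.Model (§2); BLOCK TRANSPORT — the one linear-algebra fact between the theta side's block statement (sinst-1 #1246–#1253 clsU_distU_mem_block ∕ exists_mem_holSatU_clsU_mem_block[_archSideOf_k]: tower class ∈ ⨆ ψ : (D.coinvRep χ).asModule →ₗ[ℂ[G]] Tower, range ψ, the isotypic sum of ITS OWN model of ω) and the socket's hJS clause (#95 ∕ #100 ∕ axioms-1 #6r2: ∈ ⨆ j ∈ S, block j of the PINNED dictionary): a ℂ[G]-SURJECTION (e.g. the datum-seam iso) φ : Ω(t) ↠ M carries ⨆ ψ : M →ₗ H, range ψ into oscImage t (range ψ = range (ψ ∘ φ)). §1 generic over any LiuAlbaneseModuleDatum D and ℂ[G]-module M: iSup_range_le_oscImage_of_surjective ∕ _of_equiv, iSup_range_le_block_of_surjective ∕ _of_equiv, **mem_biSup_block_of_mem_iSup_range** (x in the M-isotypic sum, μ ∈ S, ω(μ,a) ↠ M ⇒ x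 ∈ ⨆ μ ∈ S, block μ); §2 at axioms-1's indexed instance: **mem_biSup_block_weilFamily_of_mem_iSup_range** ∕ **mem_biSup_block_weilFamilyAut_of_mem_iSup_range** (x ∈ ⨆ ψ : M →ₗ[ℂ[U(V)(𝔸_f)]] Tower, range ψ + j ∈ S + good χ on line j + ℂ[U(V)(𝔸_f)]-surjection (line j).Ω ιV χ ↠ M ⇒ x ∈ ⨆ j ∈ S, block j — the exact membership hJS asks for; at the honest side M := (D.coinvRep χ').asModule, φ := DATUM SEAM 2's identification). Plumbing only; nothing asserted about any instance. CERT lane farm lean-direct over g19∕farm∕mirror = PKG RUN-67 oleans of record (refreshed 00:30:42Z after p-g28's back-sync, 4 546): rc 0 ∕ 35 s ∕ 0 warn ∕ 0 proof holes; #print axioms 7 ∕ 7 ⊆ {propext, Classical.choice, Quot.sound}, proof-holeAx 0 (g19∕farm∕logs∕ax_bt.log cfc4a6283b09); FQN 0 ∕ 7 vs headline-decls (RUN 67) + PKG + other lanes' stage6x. NAME LIST (theorems): HodgeCM.Literature.Theta.LiuAlbaneseModuleDatum.mem_biSup_block_of_mem_iSup_range · HodgeCM.Model.mem_biSup_block_weilFamily_of_mem_iSup_range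 · HodgeCM.Model.mem_biSup_block_weilFamilyAut_of_mem_iSup_range. (`HOME/mc/pub-hodgecm-mc-binder-2/g19/stage68/HodgeCM/Model/Binders/JLiuBlockTransport.lean`, md5 d44a641938bb, 127 lines);
landed by the second packager p2 gen 16 (p2-g16) in gate run 68 as `HodgeCM/Model/Binders/JLiuBlockTransport.lean` (verbatim).
-/
/-
Origin: BINDER seat `prover-pub-hodgecm-mc-binder-2-g19-0` (unit pub-hodgecm-mc-binder-2-g19, gen 19 of mc-binder-2), 2026-08-21.
Target in PKG: `HodgeCM/Model/Binders/JLiuBlockTransport.lean` (NEW additive KERNEL leaf beside E; imports LANDED axioms-1 #6r2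
`Model/LiuDictionaryInstanceLevel` only; nothing imports it; outside E's import closure; E `Model/E2InstanceOGR21AEPI.lean` 4c667377ea4b
untouched; MODEL-N ±0).
KERNEL ONLY: theorems; 0 defs, 0 records, nothing cited, 0 `def … : Prop`. Nothing here is a claim of the manuscripts under adjudication.
-/
import Summits.HodgeConjecture.HodgeCM.Model.LiuDictionaryInstanceLevel

set_option autoImplicit false

/-!
# (J3) BLOCK TRANSPORT — how a block-membership statement over ANOTHER model of `ω(μ,ε,χ)` feeds the socket's `hJS` clause

The theta side (sinst-1 #1246–#1253 `ThetaDistDatum.clsU_distU_mem_block` ∕ `exists_mem_holSatU_clsU_mem_block[_archSideOf_k]`) places the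
tower class of every theta form of a slot in `⨆ ψ : (D.coinvRep χ).asModule →ₗ[ℂ[G]] Tower, range ψ` — the isotypic sum of ITS OWN coinvariant
module `Ω_D(χ)`.  The junction's socket (binder-2 #95 ∕ #100, axioms-1 #6r2) wants membership in the PINNED dictionary's
`⨆ j ∈ S, block j`, `block j = ⨆_{χ good} oscImage (line j, χ)`, `oscImage t = ⨆ ψ : Ω(t) →ₗ[ℂ[G]] H, range ψ`.  The passage is ONE fact of
linear algebra: a `ℂ[G]`-SURJECTION `φ : Ω(t) ↠ M` (in particular the DATUM-SEAM identification `Ω(line j, χ) ≃ₗ[ℂ[G]] Ω_D(χ')`) carries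
`⨆ ψ : M →ₗ H, range ψ` INTO `oscImage t` (`range ψ = range (ψ ∘ φ)`).  This leaf types it once, generically and at the pinned instance:

* `LiuAlbaneseModuleDatum.iSup_range_le_oscImage_of_surjective` ∕ `_of_equiv`, `iSup_range_le_block_of_surjective` ∕ `_of_equiv`,
  `mem_biSup_block_of_mem_iSup_range` (generic datum `D`, any `ℂ[G]`-module `M`);
* `mem_biSup_block_weilFamily_of_mem_iSup_range` — at axioms-1's indexed instance `liuDictionaryOfWeilFamily … ιV I line GoodChar`:
  from `x ∈ ⨆ ψ : M →ₗ[ℂ[U(V)(𝔸_f)]] Tower, range ψ`, an index `j ∈ S`, a good character `χ` of `line j` and a `ℂ[U(V)(𝔸_f)]`-surjection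
  `(line j).Ω ιV χ ↠ M`, conclude `x ∈ ⨆ j ∈ S, block j` — the exact membership the `hJS` clause of #95 ∕ #100 ∕ #6r2 asks for.
Plumbing only; nothing asserted about any instance.
-/

noncomputable section

open Function Set
open NumberField
open Literature.AlgebraicGeometry.Motives
open Literature.AlgebraicGeometry.ShimuraVarieties
open Literature.AlgebraicGeometry.HodgeTheory
open Literature.NumberTheory.Automorphic
open Literature.NumberTheory.Automorphic.PicardCM
open Literature.NumberTheory.Transcendental (Arapura2012_Cor_15_4_6)

/-! ## §1. Generic: isotypic sums are insensitive to the model of `ω(t)` -/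

namespace HodgeCM.Literature.Theta.LiuAlbaneseModuleDatum

universe u v

variable {G : Type u} [Group G] {Lvl : Type v} {Kof : Lvl → Subgroup G} (D : LiuAlbaneseModuleDatum G Kof)
variable {M : Type*} [AddCommGroup M] [Module (MonoidAlgebra ℂ G) M]

/-- a `ℂ[G]`-SURJECTION `ω(t) ↠ M` carries every `ℂ[G]`-image of `M` in `H` into `oscImage t`. [folklore] -/
theorem iSup_range_le_oscImage_of_surjective (t : D.Triple) (φ : D.Ωt t →ₗ[MonoidAlgebra ℂ G] M) (hφ : Surjective φ) :
    ⨆ ψ : M →ₗ[MonoidAlgebra ℂ G] D.H, (LinearMap.range ψ).restrictScalars ℂ ≤ D.oscImage t := by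
  refine iSup_le fun ψ => ?_
  have h : LinearMap.range (ψ ∘ₗ φ) = LinearMap.range ψ := LinearMap.range_comp_of_range_eq_top ψ (LinearMap.range_eq_top.2 hφ)
  rw [← h]
  exact D.range_le_oscImage t (ψ ∘ₗ φ)

/-- the same for a `ℂ[G]`-ISOMORPHISM `ω(t) ≃ M` (e.g. the datum-seam identification of two models of `ω(μ, ε, χ)`). [folklore] -/
theorem iSup_range_le_oscImage_of_equiv (t : D.Triple) (e : D.Ωt t ≃ₗ[MonoidAlgebra ℂ G] M) :
    ⨆ ψ : M →ₗ[MonoidAlgebra ℂ G] D.H, (LinearMap.range ψ).restrictScalars ℂ ≤ D.oscImage t :=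
  D.iSup_range_le_oscImage_of_surjective t e.toLinearMap e.surjective

/-- … hence into the `μ`-block. [folklore] -/
theorem iSup_range_le_block_of_surjective (μ : D.Char) (a : D.Adm μ) (φ : D.Ω μ a →ₗ[MonoidAlgebra ℂ G] M)
    (hφ : Surjective φ) :
    ⨆ ψ : M →ₗ[MonoidAlgebra ℂ G] D.H, (LinearMap.range ψ).restrictScalars ℂ ≤ D.block μ :=
  (D.iSup_range_le_oscImage_of_surjective ⟨μ, a⟩ φ hφ).trans (D.oscImage_le_block ⟨μ, a⟩)

/-- (Ported verbatim from the HodgeCMPerL package; no docstring in the source.) -/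
theorem iSup_range_le_block_of_equiv (μ : D.Char) (a : D.Adm μ) (e : D.Ω μ a ≃ₗ[MonoidAlgebra ℂ G] M) :
    ⨆ ψ : M →ₗ[MonoidAlgebra ℂ G] D.H, (LinearMap.range ψ).restrictScalars ℂ ≤ D.block μ :=
  D.iSup_range_le_block_of_surjective μ a e.toLinearMap e.surjective

/-- **membership form over a finite index set**: `x` in the `M`-isotypic sum, `μ ∈ S`, `ω(μ, a) ↠ M` ⇒ `x ∈ ⨆ μ ∈ S, block μ`. [folklore] -/
theorem mem_biSup_block_of_mem_iSup_range {S : Finset D.Char} {μ : D.Char} (hμ : μ ∈ S) (a : D.Adm μ)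
    (φ : D.Ω μ a →ₗ[MonoidAlgebra ℂ G] M) (hφ : Surjective φ) {x : D.H}
    (hx : x ∈ ⨆ ψ : M →ₗ[MonoidAlgebra ℂ G] D.H, (LinearMap.range ψ).restrictScalars ℂ) :
    x ∈ ⨆ μ ∈ S, D.block μ :=
  (le_iSup₂ (f := fun μ (_ : μ ∈ S) => D.block μ) μ hμ) (D.iSup_range_le_block_of_surjective μ a φ hφ hx)

end HodgeCM.Literature.Theta.LiuAlbaneseModuleDatum

/-! ## §2. At axioms-1's indexed instance (#6r2): the `hJS` block clause from a theta-side isotypic membership -/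

namespace HodgeCM.Model

open HodgeCM.Model.TowerLevel HodgeCM.Model.TowerCarrier HodgeCM.Literature.Theta HodgeCM.Literature.Theta.LiuAlbaneseModuleDatum
open HodgeCM.CMTypeOps (inflate)
open HodgeCM.Universe (ThetaModel)

variable (hHD : exists_isReal_hodgeModel) (hI : hodgePQ_independent_of_hodgeModel)
  (h₁ : BallQuotientUniformised) (h₃ : CMAbelianVarietyRealised) (hA : Arapura2012_Cor_15_4_6)
variable {L : CMField} {ι₁ : (L : Type) →+* ℂ} (V : HermSpace3 L ι₁)
variable {JV : Matrix (Fin 3) (Fin 3) (L : Type)} {TV : Matrix (Fin 3) (Fin 3) ↥(maximalRealSubfield (L : Type))}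
  {δ : (L : Type)} {hcδ : IsCMField.complexConj (L : Type) δ = -δ} {hδ : δ ≠ 0} {d : ↥(maximalRealSubfield (L : Type))}
  {hd : δ * δ = algebraMap _ (L : Type) d} {hV : TV.IsSymm} {hVd : IsUnit TV.det}
  {hJV : JV = TV.map (algebraMap _ (L : Type))}
  (ιV : ↥V.adelicFin →*
    ↥(UnitaryGroup.finAdelic (↥(maximalRealSubfield (L : Type))) (L : Type) (IsCMField.complexConj (L : Type)) 3 JV))
  (I : Type) (line : I → SplitLine JV TV hcδ hδ hd hV hVd hJV) (GoodCharI : (i : I) → (line i).CharW → Prop)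

/-- **THE `hJS` BLOCK CLAUSE FROM THE THETA SIDE'S OWN MODEL**: a tower vector in the isotypic sum of ANY `ℂ[U(V)(𝔸_f)]`-module `M` that is a
`ℂ[U(V)(𝔸_f)]`-quotient of `Ω(line j, χ)` for an index `j ∈ S` and a good character `χ` lies in `⨆ j ∈ S, block j` of the pinned dictionary.
(At the honest side: `M := (D.coinvRep χ').asModule` of sinst-1's `ThetaDistDatum`, `φ` = the datum-seam identification.) [folklore] -/
theorem mem_biSup_block_weilFamily_of_mem_iSup_range {M : Type*} [AddCommGroup M] [Module (adelicAlgebra V) M]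
    {S : Finset I} {j : I} (hj : j ∈ S) {χ : (line j).CharW} (hχ : GoodCharI j χ)
    (φ : (line j).Ω ιV χ →ₗ[adelicAlgebra V] M) (hφ : Surjective φ)
    {x : Tower hHD hI (ballQuotientUniformisedDatum_of h₁) h₃ hA V}
    (hx : x ∈ ⨆ ψ : M →ₗ[adelicAlgebra V] Tower hHD hI (ballQuotientUniformisedDatum_of h₁) h₃ hA V,
      (LinearMap.range ψ).restrictScalars ℂ) :
    (x : (liuDictionaryOfWeilFamily hHD hI h₁ h₃ hA V ιV I line GoodCharI).H) ∈
      ⨆ j ∈ S, (liuDictionaryOfWeilFamily hHD hI h₁ h₃ hA V ιV I line GoodCharI).block j :=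
  (liuDictionaryOfWeilFamily hHD hI h₁ h₃ hA V ιV I line GoodCharI).mem_biSup_block_of_mem_iSup_range hj ⟨χ, hχ⟩ φ hφ hx

/-- the same at the `GoodChar` OF RECORD (`liuDictionaryOfWeilFamilyAut`, `χ` automorphic). [folklore] -/
theorem mem_biSup_block_weilFamilyAut_of_mem_iSup_range {M : Type*} [AddCommGroup M] [Module (adelicAlgebra V) M]
    {S : Finset I} {j : I} (hj : j ∈ S) {χ : (line j).CharW} (hχ : (line j).IsAutChar χ)
    (φ : (line j).Ω ιV χ →ₗ[adelicAlgebra V] M) (hφ : Surjective φ)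
    {x : Tower hHD hI (ballQuotientUniformisedDatum_of h₁) h₃ hA V}
    (hx : x ∈ ⨆ ψ : M →ₗ[adelicAlgebra V] Tower hHD hI (ballQuotientUniformisedDatum_of h₁) h₃ hA V,
      (LinearMap.range ψ).restrictScalars ℂ) :
    (x : (liuDictionaryOfWeilFamilyAut hHD hI h₁ h₃ hA V ιV I line).H) ∈
      ⨆ j ∈ S, (liuDictionaryOfWeilFamilyAut hHD hI h₁ h₃ hA V ιV I line).block j :=
  mem_biSup_block_weilFamily_of_mem_iSup_range hHD hI h₁ h₃ hA V ιV I line (fun i χ => (line i).IsAutChar χ) hj hχ φ hφ hx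

end HodgeCM.Model

end
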